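/-
Copyright (c) 2026 the pub-hodgecm-mathlib formalisation cell (harness21).  Prover seat hodgecm-mathlib-K2Liu-p03 (g6): Track B «K2-LIT»,
#184♮ = hLiu418 = stmt-HodgeConjecture-24832, road `K2_Liu`, Road I organ (A-int)-fin, A7-reg (GK COCYCLE road), file B1b-2b
(K2Liu-p09 (g5) «B1b NEEDS (for B4)» 2026-09-04T08:15:32Z (4): homeomorphism + Haar factorisation of `N_Δ(F_v)` at `n = 2`).
-/
import Summits.HodgeConjecture.HodgeConjecture.Theorems.K2LiuDoubledUTwoTwoUnipotentCoordinates   -- ★ B1b-2a: `coordTwo_*`, surjectivity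
import Summits.HodgeConjecture.HodgeConjecture.Theorems.K2LiuUnipDeltaRankOneHaar               -- ★ `continuous_blkB_matA` (generic `n`)
import HarnessLib

/-!
# Crux `HLiu418`, road `K2_Liu`, organ (A-int)-fin, A7-reg file B1b-2b: `F_v × (E ⊗ F_v) × F_v ≃ₜ N_Δ(F_v)` AT `n = 2` AND THE HAAR TRANSPORT
# `∫_{N_Δ(F_v)} f(u) dνN(u) = ∫ f(Q n(ι_v(b₁)δ, z, ι_v(b₂)δ) Q⁻¹) d(νN ∘ e)(b₁,z,b₂)`, `νN ∘ e` an ADDITIVE Haar measure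

Cell `hodgecm-mathlib`, crux item hLiu418 = `stmt-HodgeConjecture-24832`; squad K2 ∕ K2Liu; prover K2Liu-p03 (g6).  THEOREMS ONLY (no `def`, no instance,
no notation, no named-fact hypothesis, no `sorry`); lane `--supports stmt-HodgeConjecture-24832 --as helper`.  The `n = 2` twin of ★ `K2LiuUnipDeltaRankOneHaar`.

Setting of ★ B1b-1∕B1b-2a: `H_v = U(T₂ ⊕ −T₂)(F_v)`, frame `Q = e₂∘(1 D; 1 −D)` (`D Dinv = Dinv D = 1`), `frameConj Q`, `toLocalFour`, the coordinate element
`coordTwo(b₁,z,b₂) := Q n(ι_v(b₁)δ, z, ι_v(b₂)δ) Q⁻¹ ∈ N_Δ(F_v)` (★ `coordTwo_mem∕_add∕_injective`, `exists_coordTwo_eq`).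
* §1 continuity of the coordinate map and of its inverse `u ↦ (ψ(X₁₀), X₀₀, ψ(X₀₁))`, `X = B(u)·D_v`, `ψ = im-part` (★ `continuous_blkB_matA`, ★ `quadraticLocalEquiv`).
* §2 **`exists_homeomorph_coordTwo`**: a homeomorphism `e : F_v × (E ⊗ F_v) × F_v ≃ₜ N_Δ(F_v)` with `e(b₁,z,b₂) = coordTwo(b₁,z,b₂)` and `e(p + p′) = e p · e p′`.
* §3 HAAR TRANSPORT for ANY such `e`: **`isAddHaarMeasure_map_symm`** (`νN ∘ e` is an additive Haar measure on `F_v × (E⊗F_v) × F_v` — hence a constant multiple of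
  any product Haar measure, Mathlib `Measure.isAddLeftInvariant_eq_smul`), and **`integral_comp_coordTwo`**:
  `∫ f(u) dνN(u) = ∫ f(coordTwo p) d(νN ∘ e)(p)` for every `f` (measurable equivalence, no integrability needed) — with ★ B1a-2 `weylSiegel_mul_nSiegel` and ★ B1b-1
  `adapt_matA_weylDelta_mul_frameConj_weylSiegel` this is the plumbing of the cocycle `M_w(s) = A₂ A₁ A₂` (file B4, K2Liu-p09).
HONEST LABEL.  Count-neutral helper: `HC_CM` is proved only modulo the 7 printed citations (2 remaining named inputs: hLiu418 = `stmt-HodgeConjecture-24832`,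
h413 = `stmt-HodgeConjecture-24833`) until rung 0 closes.

## References
* [Weil1965] A. Weil, *L'intégration dans les groupes topologiques* (1965): §37 (Haar transport along an isomorphism).
* [HarrisKudlaSweet1996] M. Harris, S. Kudla, W. J. Sweet, J. AMS 9 (1996): §1 (1.11)–(1.12), §6 (6.14).   * [Casselman1980] W. Casselman, Compositio 40: §3.
-/

set_option autoImplicit false
set_option linter.dupNamespace false -- the mandated namespace repeats `HodgeConjecture.HodgeConjecture`

noncomputable section

open NumberField IsDedekindDomain Matrix MeasureTheory Topology
open Literature.NumberTheory.Automorphic Literature.NumberTheory.Automorphic.UnitaryGroup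
open Literature.NumberTheory.GelbartRogawski1991.AdaptedBlocks
open Literature.NumberTheory.GelbartRogawski1991.UnitaryDualPair.LocalSplitting
open Literature.NumberTheory.K2Lit.LocalSiegelDoubled
open Summit.HodgeConjecture.HodgeConjecture.Cruxes.HLiu418.K2LiuLocalSiegelIwasawa
open Summit.HodgeConjecture.HodgeConjecture.Cruxes.HLiu418.K2LiuDoubledUTwoTwoBorelFrame
open Summit.HodgeConjecture.HodgeConjecture.Cruxes.HLiu418.K2LiuDoubledUTwoTwoWeylCocycle
open Summit.HodgeConjecture.HodgeConjecture.Cruxes.HLiu418.K2LiuDoubledUTwoTwoFrameTransport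
open Summit.HodgeConjecture.HodgeConjecture.Cruxes.HLiu418.K2LiuUnipDeltaRankOneCoordinates
open Summit.HodgeConjecture.HodgeConjecture.Cruxes.HLiu418.K2LiuUnipDeltaRankOneHaar
open Summit.HodgeConjecture.HodgeConjecture.Cruxes.HLiu418.K2LiuDoubledUTwoTwoUnipotentCoordinates

namespace Summit.HodgeConjecture.HodgeConjecture.Cruxes.HLiu418.K2LiuDoubledUTwoTwoUnipotentHaar

variable (F : Type) [Field F] [NumberField F] (E : Type) [Field E] [NumberField E] [Algebra F E]
  [Algebra.IsQuadraticExtension F E] (c : E ≃ₐ[F] E)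
  {δ : E} (hcδ : c δ = -δ) (hδ : δ ≠ 0) (v : HeightOneSpectrum (𝓞 F))
  {T₂ : Matrix (Fin 2) (Fin 2) F} {J₂D : Matrix (Fin (2 + 2)) (Fin (2 + 2)) E} (hJ₂D : J₂D = (gramD F 2 T₂).map (algebraMap F E))
  (D Dinv : Matrix (Fin 2) (Fin 2) F) (hDD : D * Dinv = 1) (hDD' : Dinv * D = 1) (Q : GL (Fin (2 + 2)) F)
  (hQm : (Q : Matrix (Fin (2 + 2)) (Fin (2 + 2)) F) = Matrix.reindex (e₂ 2) (e₂ 2) (Matrix.fromBlocks 1 D 1 (-D)))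
  (hQ : (Q : Matrix (Fin (2 + 2)) (Fin (2 + 2)) F)ᵀ * gramD F 2 T₂ * (Q : Matrix (Fin (2 + 2)) (Fin (2 + 2)) F) = (StdForm.antidiagonal (2 + 2)).over F)

/-! ## §1 Continuity of the coordinate and of its inverse -/

omit [Algebra.IsQuadraticExtension F E] in
/-- **continuity of `unitaryOfMatrix'` in its matrix**: if `x ↦ M x` is continuous then so is `x ↦ unitaryOfMatrix' (M x)` (the inverse `J₄ σ(M)ᵀ J₄` is continuous too;
`σ = c ⊗ 1` is continuous). [cite: Weil1965, §37] -/
theorem continuous_unitaryOfMatrix' {X : Type*} [TopologicalSpace X] (M : X → Matrix (Fin 4) (Fin 4) (UnitaryGroup.LocalRing E v))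
    (hM : ∀ x, ((M x).map (UnitaryGroup.conjLocal E c v))ᵀ * antidiagFour (UnitaryGroup.LocalRing E v) * M x = antidiagFour (UnitaryGroup.LocalRing E v))
    (hc : Continuous M) :
    Continuous fun x => unitaryOfMatrix' (UnitaryGroup.LocalRing E v) (UnitaryGroup.conjLocal E c v) (M x) (hM x) := by
  refine Continuous.subtype_mk (Units.continuous_iff.2 ⟨?_, ?_⟩) _
  · exact hc
  · exact (continuous_const.matrix_mul ((hc.matrix_map (UnitaryGroup.continuous_conjLocal E c v)).matrix_transpose)).matrix_mul continuous_const

/-- `(b₁,z,b₂) ↦ n(ι_v(b₁)δ, z, ι_v(b₂)δ) ∈ U(J₄)(E ⊗ F_v)` is continuous (product of three continuous root letters). [cite: Weil1965, §37] -/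
theorem continuous_nSiegel_coord :
    Continuous fun p : v.adicCompletion F × UnitaryGroup.LocalRing E v × v.adicCompletion F =>
      nSiegel (UnitaryGroup.LocalRing E v) (UnitaryGroup.conjLocal E c v) (UnitaryGroup.conjLocal_conjLocal c v hcδ hδ)
        (UnitaryGroup.toLocalRing E v p.1 * algebraMap E (UnitaryGroup.LocalRing E v) δ) p.2.1
        (UnitaryGroup.toLocalRing E v p.2.2 * algebraMap E (UnitaryGroup.LocalRing E v) δ)
        (conjLocal_coord F E c hcδ v p.1) (conjLocal_coord F E c hcδ v p.2.2) := by
  have h1 : Continuous fun p : v.adicCompletion F × UnitaryGroup.LocalRing E v × v.adicCompletion F =>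
      UnitaryGroup.toLocalRing E v p.1 * algebraMap E (UnitaryGroup.LocalRing E v) δ :=
    ((UnitaryGroup.continuous_toLocalRing E v).comp continuous_fst).mul continuous_const
  have h2 : Continuous fun p : v.adicCompletion F × UnitaryGroup.LocalRing E v × v.adicCompletion F => p.2.1 := continuous_fst.comp continuous_snd
  have h3 : Continuous fun p : v.adicCompletion F × UnitaryGroup.LocalRing E v × v.adicCompletion F => -UnitaryGroup.conjLocal E c v p.2.1 :=
    ((UnitaryGroup.continuous_conjLocal E c v).comp h2).neg
  have h4 : Continuous fun p : v.adicCompletion F × UnitaryGroup.LocalRing E v × v.adicCompletion F =>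
      UnitaryGroup.toLocalRing E v p.2.2 * algebraMap E (UnitaryGroup.LocalRing E v) δ :=
    ((UnitaryGroup.continuous_toLocalRing E v).comp (continuous_snd.comp continuous_snd)).mul continuous_const
  have hL2 : Continuous fun p : v.adicCompletion F × UnitaryGroup.LocalRing E v × v.adicCompletion F =>
      uLongTwoM (UnitaryGroup.LocalRing E v) (UnitaryGroup.toLocalRing E v p.1 * algebraMap E (UnitaryGroup.LocalRing E v) δ) := by
    refine continuous_matrix fun i j => ?_
    fin_cases i <;> fin_cases j <;> simp [uLongTwoM] <;> first | exact continuous_const | exact h1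
  have hP : Continuous fun p : v.adicCompletion F × UnitaryGroup.LocalRing E v × v.adicCompletion F =>
      uPlusM (UnitaryGroup.LocalRing E v) (UnitaryGroup.conjLocal E c v) p.2.1 := by
    refine continuous_matrix fun i j => ?_
    fin_cases i <;> fin_cases j <;> simp [uPlusM] <;> first | exact continuous_const | exact h2 | exact h3
  have hL1 : Continuous fun p : v.adicCompletion F × UnitaryGroup.LocalRing E v × v.adicCompletion F =>
      uLongOneM (UnitaryGroup.LocalRing E v) (UnitaryGroup.toLocalRing E v p.2.2 * algebraMap E (UnitaryGroup.LocalRing E v) δ) := by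
    refine continuous_matrix fun i j => ?_
    fin_cases i <;> fin_cases j <;> simp [uLongOneM] <;> first | exact continuous_const | exact h4
  exact ((continuous_unitaryOfMatrix' F E c v _ _ hL2).mul (continuous_unitaryOfMatrix' F E c v _ _ hP)).mul (continuous_unitaryOfMatrix' F E c v _ _ hL1)

include hJ₂D hDD hQm in
/-- **the coordinate map `(b₁,z,b₂) ↦ Q n(ι_v(b₁)δ, z, ι_v(b₂)δ) Q⁻¹` is continuous into `N_Δ(F_v)`** (`frameConj Q`, `toLocalFour` are topological isomorphisms).
[cite: Weil1965, §37] -/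
theorem continuous_coordTwo :
    Continuous fun p : v.adicCompletion F × UnitaryGroup.LocalRing E v × v.adicCompletion F =>
      (⟨FrameTransport.frameConj F E c v (2 + 2) hJ₂D (antidiagonal_over_eq_map F E 2) Q hQ
        (toLocalFour F E c v (nSiegel (UnitaryGroup.LocalRing E v) (UnitaryGroup.conjLocal E c v) (UnitaryGroup.conjLocal_conjLocal c v hcδ hδ)
          (UnitaryGroup.toLocalRing E v p.1 * algebraMap E (UnitaryGroup.LocalRing E v) δ) p.2.1
          (UnitaryGroup.toLocalRing E v p.2.2 * algebraMap E (UnitaryGroup.LocalRing E v) δ)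
          (conjLocal_coord F E c hcδ v p.1) (conjLocal_coord F E c hcδ v p.2.2))),
        coordTwo_mem F E c hcδ hδ v hJ₂D D Dinv hDD Q hQm hQ p.1 p.2.1 p.2.2⟩ : unipDeltaLocal F E c v 2 (JD := J₂D)) :=
  Continuous.subtype_mk ((FrameTransport.frameConj F E c v (2 + 2) hJ₂D (antidiagonal_over_eq_map F E 2) Q hQ).continuous.comp
    ((toLocalFour F E c v).continuous.comp (continuous_nSiegel_coord F E c hcδ hδ v))) _

include hcδ hδ in
/-- the inverse coordinate `u ↦ (ψ(X₁₀), X₀₀, ψ(X₀₁))`, `X = B(u) · D_v`, `ψ = (quadraticLocalEquiv)⁻¹ ∘ snd`, is continuous on `N_Δ(F_v)`. [cite: Weil1965, §37] -/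
theorem continuous_coordTwoInv :
    Continuous fun u : unipDeltaLocal F E c v 2 (JD := J₂D) =>
      (((quadraticLocalEquiv E v c hcδ hδ).symm ((blkB (matA F E c v 2 (u : UnitaryGroup.localPi E c (2 + 2) J₂D v)) *
          D.map ((UnitaryGroup.toLocalRing E v).comp (algebraMap F (v.adicCompletion F)))) 1 0)).2,
        (blkB (matA F E c v 2 (u : UnitaryGroup.localPi E c (2 + 2) J₂D v)) * D.map ((UnitaryGroup.toLocalRing E v).comp (algebraMap F (v.adicCompletion F)))) 0 0,
        ((quadraticLocalEquiv E v c hcδ hδ).symm ((blkB (matA F E c v 2 (u : UnitaryGroup.localPi E c (2 + 2) J₂D v)) *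
          D.map ((UnitaryGroup.toLocalRing E v).comp (algebraMap F (v.adicCompletion F)))) 0 1)).2) := by
  have hX : Continuous fun u : unipDeltaLocal F E c v 2 (JD := J₂D) =>
      blkB (matA F E c v 2 (u : UnitaryGroup.localPi E c (2 + 2) J₂D v)) * D.map ((UnitaryGroup.toLocalRing E v).comp (algebraMap F (v.adicCompletion F))) :=
    ((continuous_blkB_matA F E c v 2).comp continuous_subtype_val).matrix_mul continuous_const
  exact (continuous_snd.comp ((quadraticLocalEquiv E v c hcδ hδ).symm.continuous.comp (hX.matrix_elem 1 0))).prodMk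
    ((hX.matrix_elem 0 0).prodMk (continuous_snd.comp ((quadraticLocalEquiv E v c hcδ hδ).symm.continuous.comp (hX.matrix_elem 0 1))))

/-! ## §2 The homeomorphism `F_v × (E ⊗ F_v) × F_v ≃ₜ N_Δ(F_v)` -/

set_option maxHeartbeats 1600000 in -- the nested `frameConj (toLocalFour (nSiegel …))` terms unfold slowly
include hcδ hδ hJ₂D hDD hDD' hQm in
/-- **`F_v × (E ⊗ F_v) × F_v ≃ₜ N_Δ(F_v)`, `(b₁,z,b₂) ↦ Q n(ι_v(b₁)δ, z, ι_v(b₂)δ) Q⁻¹`**, additive-to-multiplicative.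
[cite: HarrisKudlaSweet1996, §1 (1.11)–(1.12)] [cite: Weil1965, §37] -/
theorem exists_homeomorph_coordTwo :
    ∃ e : (v.adicCompletion F × UnitaryGroup.LocalRing E v × v.adicCompletion F) ≃ₜ unipDeltaLocal F E c v 2 (JD := J₂D),
      (∀ b₁ z b₂, ((e (b₁, z, b₂) : unipDeltaLocal F E c v 2 (JD := J₂D)) : UnitaryGroup.localPi E c (2 + 2) J₂D v) =
        FrameTransport.frameConj F E c v (2 + 2) hJ₂D (antidiagonal_over_eq_map F E 2) Q hQ
          (toLocalFour F E c v (nSiegel (UnitaryGroup.LocalRing E v) (UnitaryGroup.conjLocal E c v) (UnitaryGroup.conjLocal_conjLocal c v hcδ hδ)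
            (UnitaryGroup.toLocalRing E v b₁ * algebraMap E (UnitaryGroup.LocalRing E v) δ) z
            (UnitaryGroup.toLocalRing E v b₂ * algebraMap E (UnitaryGroup.LocalRing E v) δ)
            (conjLocal_coord F E c hcδ v b₁) (conjLocal_coord F E c hcδ v b₂)))) ∧
      (∀ p p', e (p + p') = e p * e p') := by
  set φ : F →+* UnitaryGroup.LocalRing E v := (UnitaryGroup.toLocalRing E v).comp (algebraMap F (v.adicCompletion F)) with hφ
  -- forward and inverse maps
  let fwd : v.adicCompletion F × UnitaryGroup.LocalRing E v × v.adicCompletion F → unipDeltaLocal F E c v 2 (JD := J₂D) := fun p =>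
    ⟨FrameTransport.frameConj F E c v (2 + 2) hJ₂D (antidiagonal_over_eq_map F E 2) Q hQ
        (toLocalFour F E c v (nSiegel (UnitaryGroup.LocalRing E v) (UnitaryGroup.conjLocal E c v) (UnitaryGroup.conjLocal_conjLocal c v hcδ hδ)
          (UnitaryGroup.toLocalRing E v p.1 * algebraMap E (UnitaryGroup.LocalRing E v) δ) p.2.1
          (UnitaryGroup.toLocalRing E v p.2.2 * algebraMap E (UnitaryGroup.LocalRing E v) δ)
          (conjLocal_coord F E c hcδ v p.1) (conjLocal_coord F E c hcδ v p.2.2))),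
      coordTwo_mem F E c hcδ hδ v hJ₂D D Dinv hDD Q hQm hQ p.1 p.2.1 p.2.2⟩
  let inv : unipDeltaLocal F E c v 2 (JD := J₂D) → v.adicCompletion F × UnitaryGroup.LocalRing E v × v.adicCompletion F := fun u =>
    (((quadraticLocalEquiv E v c hcδ hδ).symm ((blkB (matA F E c v 2 (u : UnitaryGroup.localPi E c (2 + 2) J₂D v)) * D.map φ) 1 0)).2,
      (blkB (matA F E c v 2 (u : UnitaryGroup.localPi E c (2 + 2) J₂D v)) * D.map φ) 0 0,
      ((quadraticLocalEquiv E v c hcδ hδ).symm ((blkB (matA F E c v 2 (u : UnitaryGroup.localPi E c (2 + 2) J₂D v)) * D.map φ) 0 1)).2)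
  have hΨ : ∀ b : v.adicCompletion F, quadraticLocalEquiv E v c hcδ hδ (0, b) = UnitaryGroup.toLocalRing E v b * algebraMap E (UnitaryGroup.LocalRing E v) δ :=
    fun b => by rw [quadraticLocalEquiv_apply, map_zero, zero_add]
  have hDDφ : Dinv.map φ * D.map φ = 1 := by rw [← Matrix.map_mul, hDD', Matrix.map_one _ (map_zero φ) (map_one φ)]
  -- left inverse
  have hB : ∀ b₁ z b₂, blkB (matA F E c v 2 (FrameTransport.frameConj F E c v (2 + 2) hJ₂D (antidiagonal_over_eq_map F E 2) Q hQ
        (toLocalFour F E c v (nSiegel (UnitaryGroup.LocalRing E v) (UnitaryGroup.conjLocal E c v) (UnitaryGroup.conjLocal_conjLocal c v hcδ hδ)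
          (UnitaryGroup.toLocalRing E v b₁ * algebraMap E (UnitaryGroup.LocalRing E v) δ) z
          (UnitaryGroup.toLocalRing E v b₂ * algebraMap E (UnitaryGroup.LocalRing E v) δ)
          (conjLocal_coord F E c hcδ v b₁) (conjLocal_coord F E c hcδ v b₂))))) * D.map φ =
      !![z, UnitaryGroup.toLocalRing E v b₂ * algebraMap E (UnitaryGroup.LocalRing E v) δ;
        UnitaryGroup.toLocalRing E v b₁ * algebraMap E (UnitaryGroup.LocalRing E v) δ, -UnitaryGroup.conjLocal E c v z] := fun b₁ z b₂ => by
    rw [blkB_matA_frameConj_nSiegel F E c hcδ hδ v hJ₂D D Dinv hDD Q hQm hQ, Matrix.mul_assoc, hDDφ, Matrix.mul_one]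
  have hleft : ∀ p, inv (fwd p) = p := by
    rintro ⟨b₁, z, b₂⟩
    dsimp only [fwd, inv]
    rw [hB]
    simp only [Matrix.of_apply, Matrix.cons_val', Matrix.cons_val_zero, Matrix.cons_val_one, Matrix.empty_val', Matrix.cons_val_fin_one]
    rw [← hΨ b₁, ← hΨ b₂, ContinuousLinearEquiv.symm_apply_apply, ContinuousLinearEquiv.symm_apply_apply]
  -- right inverse
  have hright : ∀ u, fwd (inv u) = u := fun u => by
    obtain ⟨b₁, z, b₂, hu⟩ := exists_coordTwo_eq F E c hcδ hδ v hJ₂D D Dinv hDD hDD' Q hQm hQ u.2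
    have h1 : (fwd (b₁, z, b₂) : unipDeltaLocal F E c v 2 (JD := J₂D)) = u := Subtype.ext hu.symm
    rw [← h1, hleft]
  refine ⟨⟨⟨fwd, inv, hleft, hright⟩, continuous_coordTwo F E c hcδ hδ v hJ₂D D Dinv hDD Q hQm hQ, continuous_coordTwoInv F E c hcδ hδ v D⟩,
    fun b₁ z b₂ => rfl, fun p p' => ?_⟩
  exact Subtype.ext (coordTwo_add F E c hcδ hδ v hJ₂D Q hQ p.1 p.2.1 p.2.2 p'.1 p'.2.1 p'.2.2)

/-! ## §3 Haar transport along any such homeomorphism -/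

section Haar

variable [MeasurableSpace (v.adicCompletion F)] [BorelSpace (v.adicCompletion F)] [SecondCountableTopology (v.adicCompletion F)]
  [MeasurableSpace (UnitaryGroup.LocalRing E v)] [BorelSpace (UnitaryGroup.LocalRing E v)] [SecondCountableTopology (UnitaryGroup.LocalRing E v)]
  [MeasurableSpace (unipDeltaLocal F E c v 2 (JD := J₂D))] [BorelSpace (unipDeltaLocal F E c v 2 (JD := J₂D))]

omit [Algebra.IsQuadraticExtension F E] in
/-- **HAAR TRANSPORT**: for a Haar measure `νN` on `N_Δ(F_v)` and ANY additive-to-multiplicative homeomorphism `e : F_v × (E ⊗ F_v) × F_v ≃ₜ N_Δ(F_v)`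
(e.g. the one of `exists_homeomorph_coordTwo`), the push-forward `νN ∘ e = map e⁻¹ νN` is an ADDITIVE HAAR MEASURE on `F_v × (E ⊗ F_v) × F_v` — hence
`c • (μ_F ⊗ μ_R ⊗ μ_F)` for any product of additive Haar measures (Mathlib `Measure.isAddLeftInvariant_eq_smul`). [cite: Weil1965, §37] [cite: Casselman1980, §3] -/
theorem isAddHaarMeasure_map_symm (e : (v.adicCompletion F × UnitaryGroup.LocalRing E v × v.adicCompletion F) ≃ₜ unipDeltaLocal F E c v 2 (JD := J₂D))
    (hmul : ∀ p p', e (p + p') = e p * e p') (νN : Measure (unipDeltaLocal F E c v 2 (JD := J₂D))) [νN.IsHaarMeasure] :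
    (Measure.map e.symm νN).IsAddHaarMeasure := by
  haveI : IsFiniteMeasureOnCompacts (Measure.map e.symm νN) := ⟨fun K hK => by
    rw [Measure.map_apply e.symm.measurable hK.measurableSet, ← e.image_eq_preimage_symm]
    exact (hK.image e.continuous).measure_lt_top⟩
  haveI : (Measure.map e.symm νN).IsOpenPosMeasure := ⟨fun U hU hne => by
    rw [Measure.map_apply e.symm.measurable hU.measurableSet, ← e.image_eq_preimage_symm]
    exact (e.isOpenMap U hU).measure_ne_zero νN (hne.image e)⟩
  haveI : (Measure.map e.symm νN).IsAddLeftInvariant := ⟨fun b => by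
    have hadd : Continuous fun x : v.adicCompletion F × UnitaryGroup.LocalRing E v × v.adicCompletion F => b + x := continuous_const.add continuous_id
    have hmulc : Continuous fun u : unipDeltaLocal F E c v 2 (JD := J₂D) => e b * u := continuous_const.mul continuous_id
    rw [Measure.map_map hadd.measurable e.symm.measurable]
    have hcomp : ((fun x => b + x) ∘ e.symm) = (e.symm ∘ fun u => e b * u) := by
      funext u
      simp only [Function.comp_apply]
      apply e.injective
      rw [hmul, e.apply_symm_apply, e.apply_symm_apply]
    rw [hcomp, ← Measure.map_map e.symm.measurable hmulc.measurable, map_mul_left_eq_self νN (e b)]⟩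
  exact { toIsFiniteMeasureOnCompacts := inferInstance, toIsAddLeftInvariant := inferInstance, toIsOpenPosMeasure := inferInstance }

omit [Algebra.IsQuadraticExtension F E] in
/-- **change of variables**: `∫_{N_Δ(F_v)} f(u) dνN(u) = ∫ f(e p) d(νN ∘ e)(p)` for ANY `f` (no integrability needed: a measurable equivalence); with
`e` from `exists_homeomorph_coordTwo`, `e p = Q n(ι_v(b₁)δ, z, ι_v(b₂)δ) Q⁻¹`. [cite: Weil1965, §37] -/
theorem integral_comp_coordTwo (e : (v.adicCompletion F × UnitaryGroup.LocalRing E v × v.adicCompletion F) ≃ₜ unipDeltaLocal F E c v 2 (JD := J₂D))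
    (νN : Measure (unipDeltaLocal F E c v 2 (JD := J₂D))) (f : UnitaryGroup.localPi E c (2 + 2) J₂D v → ℂ) :
    ∫ u, f (u : UnitaryGroup.localPi E c (2 + 2) J₂D v) ∂νN =
      ∫ p, f ((e p : unipDeltaLocal F E c v 2 (JD := J₂D)) : UnitaryGroup.localPi E c (2 + 2) J₂D v) ∂(Measure.map e.symm νN) := by
  rw [← Homeomorph.toMeasurableEquiv_coe, integral_map_equiv]
  refine integral_congr_ae (Filter.Eventually.of_forall fun u => ?_)
  exact congrArg (fun w : unipDeltaLocal F E c v 2 (JD := J₂D) => f (w : UnitaryGroup.localPi E c (2 + 2) J₂D v)) (e.apply_symm_apply u).symm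

end Haar

end Summit.HodgeConjecture.HodgeConjecture.Cruxes.HLiu418.K2LiuDoubledUTwoTwoUnipotentHaar

end
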